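import Summits.ABC.IUTFork.LDHGenuinePerImageContentfulTameSix
import Summits.ABC.IUTFork.LDHGenuinePerImageContentfulAll
import Literature.Barriers.ABC.SzpiroEpsilonCannotBeDropped
import Literature.Barriers.ABC.BakerMethodBounds
import HarnessLib

/-!
# P-ARM-WUC (abc-iut-inv-3, cycle 2, lens `wuc`) — scratch typing of the consequence chain of the (P)-arm residual

Scratch file of an ideator seat (never proposed). Defs / theorem statements / small real-arithmetic proofs only;
NO instance, NO notation, NO sorry. Takes NO SIDE on [IUTchIII] Cor. 3.12 or any author; nothing here asserts
`Cor312PerImageAtDatum` at any point; a refuted `W` would refute OUR typed (P)-arm, not IUT and not abc; typed ≠ proved.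

`W0` = the verbatim signature of the registered open stub `stub_cor312PerImage` of the RESHAPE-4 skeleton
(3177a83aca8d622d, namespace `Summit.ABC.ABC.Cruxes.ThetaPartII.Display`), restated for bookkeeping only (the staging
module is not importable from the tree). `Wk_of_Wj` theorems are BY NAME of tree theorems or three-line logic.
-/

noncomputable section

open Literature.IUT.HodgeTheaters Literature.IUT.LogVolume NumberField IsDedekindDomain
open Literature.NumberTheory.DiophantineGeometry.GenEll
open Summit.ABC.IUTFork

namespace Summit.ABC.ABC.Cruxes.ThetaPartII.WUC3

/-! ## W0 — the (P)-arm residual and the bookkeeping frame -/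

/-- **W0** — verbatim signature of `stub_cor312PerImage` (RESHAPE-4 3177a83aca8d622d). OPEN stub; disputed in print. -/
def W0 : Prop :=
  ∀ P : NFPoint, P ∈ UP → ∀ l : ℕ, l.Prime → 5 ≤ l → Cor22.AdmitsCore P → Cor22.CondP2 P l →
    Cor22.CondP5 P l → Cor22.CondP6 P l → Cor22.Cor312PerImageAtDatum P l

/-- The admissibility bundle of the stub's binders at `(P, l)`. -/
def Admissible (P : NFPoint) (l : ℕ) : Prop :=
  P ∈ UP ∧ l.Prime ∧ 5 ≤ l ∧ Cor22.AdmitsCore P ∧ Cor22.CondP2 P l ∧ Cor22.CondP5 P l ∧ Cor22.CondP6 P l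

/-- Bookkeeping frame (dual of MJ3's `SuppliesPerImage`): `W` is a CONSEQUENCE of the (P)-arm residual. -/
def IsConsequence (W : Prop) : Prop := W0 → W

/-! ## W1 — drop uniformity in `l` -/

/-- **W1 l₀** — the stub at ONE prime `l₀` (uniformity in `l` dropped). -/
def W1 (l₀ : ℕ) : Prop := ∀ P : NFPoint, Admissible P l₀ → Cor22.Cor312PerImageAtDatum P l₀

theorem W1_isConsequence (l₀ : ℕ) : IsConsequence (W1 l₀) := by
  intro h P hA
  exact h P hA.1 l₀ hA.2.1 hA.2.2.1 hA.2.2.2.1 hA.2.2.2.2.1 hA.2.2.2.2.2.1 hA.2.2.2.2.2.2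

/-- Conversely the family `W1` recovers `W0` (so `W0 ↔ ∀ l₀, W1 l₀`: the `l`-axis is the only uniformity). -/
theorem W0_of_forall_W1 (h : ∀ l₀, W1 l₀) : W0 :=
  fun P hP l hl h5 hc h2 h5' h6 => h l P ⟨hP, hl, h5, hc, h2, h5', h6⟩

/-! ## W2 — and `d_mod = 1` (every `λ` with `j(λ) ∈ ℚ`) -/

/-- **W2 l₀** — the stub at `l₀` on the sub-family `d_mod = 1`. -/
def W2 (l₀ : ℕ) : Prop :=
  ∀ P : NFPoint, Admissible P l₀ → Cor22.dmod P = 1 → Cor22.Cor312PerImageAtDatum P l₀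

theorem W2_of_W1 {l₀ : ℕ} (h : W1 l₀) : W2 l₀ := fun P hA _ => h P hA

/-! ## W1T — the TAME-DATA number-level consequence (p437841) — and why it is vacuous AS TYPED -/

/-- **W1T l₀** — the display of `PointDict.szpiro_of_cor312PerImageAtDatum_tame_six` (p437841) as a statement about
admissible `(P, l₀)`: at every TAME genuine datum (the file's hypothesis, verbatim) the Szpiro-`6(1+O(1/l))` display. -/
def W1T (l₀ : ℕ) : Prop :=
  ∀ P : NFPoint, Admissible P l₀ → ∀ T : Cor22.ThetaVolumeDatumAt P l₀,
    (letI := T.instFieldF; letI := T.instNumberFieldF; letI := T.instAlgebraF; letI := T.instFieldK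
     letI := T.instNumberFieldK; letI := T.instAlgebraK; letI := T.instIsElliptic
     ∀ (p : ℕ) [hp : Fact p.Prime], p ∈ T.I.supportPrimes → ∀ v : placesOver (fieldOfModuli T.E) p,
       ¬ p - 2 < absRamificationIdx p ((T.I.σ.localFieldFamily p hp.out).k v)) →
    (1 / 6 - 2 / ((l₀ : ℝ) * ((l₀ : ℝ) + 1))) * Cor22.logQAvoid P {2, l₀} ≤
      (1 + (4 + 8 * (Cor22.dmod P : ℝ)) / l₀) * (P.logDiff + Cor22.logCondAvoid P {2, l₀})
        + 5 * Real.log l₀ + 46 + 2 * Real.log Real.pi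

/-- `W1T` is a consequence of `W1` for `l₀ ≥ 7` — BY NAME (p437841). -/
theorem W1T_of_W1 {l₀ : ℕ} (h7 : 7 ≤ l₀) (h : W1 l₀) : W1T l₀ :=
  fun P hA T htame => PointDict.szpiro_of_cor312PerImageAtDatum_tame_six hA.1 h7 (h P hA) T htame

variable {P : NFPoint} {l : ℕ}

/-- **VACUITY OF THE TAME HYPOTHESIS AS TYPED.** `2 ∈ T.I.supportPrimes` always (`ThetaVolumeInput.two_mem_supportPrimes`),
the field of moduli has a place over `2` (`placesOver_nonempty`), and `e ≥ 1` (`absRamificationIdx_pos`); at `p = 2` the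
hypothesis demands `¬ 2 − 2 < e`, i.e. `e = 0`. Hence NO genuine datum satisfies the tameness hypothesis of p437841 /
`szpiro_of_cor312PerImageAtDatum_tame` / `_tame_linear` as typed (the intended reading is presumably «tame at the ODD support
primes»; the non-vacuous all-data necessity is `PointDict.szpiro_of_cor312PerImageAtDatum_six_all`). Typing audit only; no side taken. -/
theorem tameHyp_false (T : Cor22.ThetaVolumeDatumAt P l)
    (htame : letI := T.instFieldF; letI := T.instNumberFieldF; letI := T.instAlgebraF; letI := T.instFieldK
      letI := T.instNumberFieldK; letI := T.instAlgebraK; letI := T.instIsElliptic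
      ∀ (p : ℕ) [hp : Fact p.Prime], p ∈ T.I.supportPrimes → ∀ v : placesOver (fieldOfModuli T.E) p,
        ¬ p - 2 < absRamificationIdx p ((T.I.σ.localFieldFamily p hp.out).k v)) : False := by
  letI := T.instFieldF; letI := T.instNumberFieldF; letI := T.instAlgebraF; letI := T.instFieldK
  letI := T.instNumberFieldK; letI := T.instAlgebraK; letI := T.instIsElliptic
  haveI : Fact (Nat.Prime 2) := ⟨Nat.prime_two⟩
  obtain ⟨v, hv⟩ := placesOver_nonempty (fieldOfModuli T.E) 2
  have h := htame 2 T.I.two_mem_supportPrimes ⟨v, hv⟩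
  exact h (by simpa using absRamificationIdx_pos 2 ((T.I.σ.localFieldFamily 2 Nat.prime_two).k ⟨v, hv⟩))

/-- Hence `W1T l₀` HOLDS UNCONDITIONALLY for every `l₀` — for the wrong reason (empty datum class): the tame floor is not a
contentful consequence of the (P)-arm as typed. -/
theorem W1T_holds (l₀ : ℕ) : W1T l₀ := fun _ _ T htame => (tameHyp_false T htame).elim

/-! ## W3 — the contentful ALL-DATA number-level consequence at fixed `l₀ ≥ 7` -/

/-- **W3 l₀** — the display of `PointDict.szpiro_of_cor312PerImageAtDatum_six_all` as a statement about admissible `(P, l₀)`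
with a genuine datum: Szpiro slope `(1 + (4+8·d_mod)/l₀)/(1/6 − 2/(l₀(l₀+1)))` and the explicit ramification-bound intercept
`5/3·(3 + log E)·(E + 3)`, `E = 184320·[F:ℚ]·l₀⁴`. -/
def W3 (l₀ : ℕ) : Prop :=
  ∀ P : NFPoint, Admissible P l₀ → Cor22.ThetaDataExistsAt P l₀ →
    (1 / 6 - 2 / ((l₀ : ℝ) * ((l₀ : ℝ) + 1))) * Cor22.logQAvoid P {2, l₀} ≤
      (1 + (4 + 8 * (Cor22.dmod P : ℝ)) / l₀) * (P.logDiff + Cor22.logCondAvoid P {2, l₀})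
        + 5 * Real.log l₀ + 46 + 2 * Real.log Real.pi
        + 5 / 3 * (3 + Real.log ((184320 * P.degree * l₀ ^ 4 : ℕ) : ℝ)) * (((184320 * P.degree * l₀ ^ 4 : ℕ) : ℝ) + 3)

/-- `W3` is a consequence of `W1` for `l₀ ≥ 7` — BY NAME (`szpiro_of_cor312PerImageAtDatum_six_all`). -/
theorem W3_of_W1 {l₀ : ℕ} (h7 : 7 ≤ l₀) (h : W1 l₀) : W3 l₀ := by
  intro P hA hT
  obtain ⟨T⟩ := hT
  exact PointDict.szpiro_of_cor312PerImageAtDatum_six_all hA.1 h7 (h P hA) T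

/-! ## W8 — the SLACK REGIME: `W3`'s display is a THEOREM (without the stub) whenever `log q^{∤2l₀} ≤ 5529600·l₀⁴` -/

/-- **Slack regime (kernel).** For every point and every `l ≥ 7`, if `log q^{∤{2,l}}(λ) ≤ 5529600·l⁴` then the display of `W3`
holds outright: the ramification intercept alone exceeds the left side. So the (P)-arm's number-level consequence has content
only for `log q^{∤{2,l}} > 5529600·l⁴` (`≥ 1.33·10¹⁰` nats at `l = 7`). Pure real arithmetic; no side taken. -/
theorem slack_regime (P : NFPoint) (l : ℕ) (h7 : 7 ≤ l)
    (hQ : Cor22.logQAvoid P {2, l} ≤ 5529600 * (l : ℝ) ^ 4) :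
    (1 / 6 - 2 / ((l : ℝ) * ((l : ℝ) + 1))) * Cor22.logQAvoid P {2, l} ≤
      (1 + (4 + 8 * (Cor22.dmod P : ℝ)) / l) * (P.logDiff + Cor22.logCondAvoid P {2, l})
        + 5 * Real.log l + 46 + 2 * Real.log Real.pi
        + 5 / 3 * (3 + Real.log ((184320 * P.degree * l ^ 4 : ℕ) : ℝ)) * (((184320 * P.degree * l ^ 4 : ℕ) : ℝ) + 3) := by
  set Q : ℝ := Cor22.logQAvoid P {2, l} with hQdef
  set L : ℝ := P.logDiff + Cor22.logCondAvoid P {2, l} with hLdef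
  set E : ℝ := ((184320 * P.degree * l ^ 4 : ℕ) : ℝ) with hEdef
  have hl : (7 : ℝ) ≤ l := by exact_mod_cast h7
  have hQ0 : 0 ≤ Q := Cor22.logQAvoid_nonneg P _
  have hL0 : 0 ≤ L := add_nonneg P.logDiff_nonneg (Cor22.logCondAvoid_nonneg P _)
  have hd0 : (0 : ℝ) ≤ (Cor22.dmod P : ℝ) := by positivity
  have hdeg : 1 ≤ P.degree := Module.finrank_pos
  have hEn : 184320 * 1 * l ^ 4 ≤ 184320 * P.degree * l ^ 4 :=
    Nat.mul_le_mul_right _ (Nat.mul_le_mul_left _ hdeg)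
  have hE : 184320 * (l : ℝ) ^ 4 ≤ E := by
    have := (Nat.cast_le (α := ℝ)).mpr hEn
    rw [hEdef]
    push_cast at this ⊢
    linarith
  have hl4 : (1 : ℝ) ≤ (l : ℝ) ^ 4 := one_le_pow₀ (by linarith)
  have hE1 : 1 ≤ E := by linarith
  have hlogE : 0 ≤ Real.log E := Real.log_nonneg hE1
  have hlogl : 0 ≤ Real.log l := Real.log_nonneg (by linarith)
  have hpi : 0 ≤ Real.log Real.pi := Real.log_nonneg (by linarith [Real.pi_gt_three])
  have hfrac : 0 ≤ 2 / ((l : ℝ) * ((l : ℝ) + 1)) := by positivity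
  have h1 : (1 / 6 - 2 / ((l : ℝ) * ((l : ℝ) + 1))) * Q ≤ Q / 6 := by nlinarith
  have hcoef : 0 ≤ 1 + (4 + 8 * (Cor22.dmod P : ℝ)) / l := by positivity
  have h2 : 0 ≤ (1 + (4 + 8 * (Cor22.dmod P : ℝ)) / l) * L := mul_nonneg hcoef hL0
  have h3 : 5 * E ≤ 5 / 3 * (3 + Real.log E) * (E + 3) := by nlinarith
  linarith

/-- **W8 l₀** — `W3 l₀` restricted to the slack regime. A THEOREM for every `l₀ ≥ 7` (`W8_holds`), hence BELOW `W*`. -/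
def W8 (l₀ : ℕ) : Prop :=
  ∀ P : NFPoint, Cor22.logQAvoid P {2, l₀} ≤ 5529600 * (l₀ : ℝ) ^ 4 →
    (1 / 6 - 2 / ((l₀ : ℝ) * ((l₀ : ℝ) + 1))) * Cor22.logQAvoid P {2, l₀} ≤
      (1 + (4 + 8 * (Cor22.dmod P : ℝ)) / l₀) * (P.logDiff + Cor22.logCondAvoid P {2, l₀})
        + 5 * Real.log l₀ + 46 + 2 * Real.log Real.pi
        + 5 / 3 * (3 + Real.log ((184320 * P.degree * l₀ ^ 4 : ℕ) : ℝ)) * (((184320 * P.degree * l₀ ^ 4 : ℕ) : ℝ) + 3)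

theorem W8_holds {l₀ : ℕ} (h7 : 7 ≤ l₀) : W8 l₀ := fun P hQ => slack_regime P l₀ h7 hQ

/-! ## W4, W5 — weaken the constants (degree-one, `d_mod = 1` sub-family: `λ ∈ ℚ`) -/

/-- **W4 l₀** — `∃` intercept: Szpiro with the stub's slope `(1 + 12/l₀)/(1/6 − 2/(l₀(l₀+1)))` and SOME additive constant, on the
rational sub-family (`[F:ℚ] = 1`, `d_mod = 1`) with a genuine datum. -/
def W4 (l₀ : ℕ) : Prop :=
  ∃ A : ℝ, ∀ P : NFPoint, Admissible P l₀ → P.degree = 1 → Cor22.dmod P = 1 → Cor22.ThetaDataExistsAt P l₀ →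
    (1 / 6 - 2 / ((l₀ : ℝ) * ((l₀ : ℝ) + 1))) * Cor22.logQAvoid P {2, l₀} ≤
      (1 + 12 / (l₀ : ℝ)) * (P.logDiff + Cor22.logCondAvoid P {2, l₀}) + A

theorem W4_of_W3 {l₀ : ℕ} (h : W3 l₀) : W4 l₀ := by
  refine ⟨5 * Real.log l₀ + 46 + 2 * Real.log Real.pi
      + 5 / 3 * (3 + Real.log ((184320 * 1 * l₀ ^ 4 : ℕ) : ℝ)) * (((184320 * 1 * l₀ ^ 4 : ℕ) : ℝ) + 3), ?_⟩
  intro P hA hdeg hd hT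
  have h3 := h P hA hT
  rw [hdeg] at h3
  have hdR : (Cor22.dmod P : ℝ) = 1 := by exact_mod_cast hd
  rw [hdR] at h3
  have e : (1 + (4 + 8 * (1 : ℝ)) / l₀) = 1 + 12 / (l₀ : ℝ) := by norm_num
  rw [e] at h3
  linarith

/-- **W5 l₀** — SZPIRO SHAPE with unspecified slope and intercept on the same sub-family: `log q^{∤2l₀} ≤ c·(log-diff + log-cond) + A`.
(`Literature.NumberTheory.EllipticCurves.SzpiroConjecture` restricted to the admissible-at-`l₀` rational Legendre family, away from `2l₀`.) -/
def W5 (l₀ : ℕ) : Prop :=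
  ∃ c A : ℝ, ∀ P : NFPoint, Admissible P l₀ → P.degree = 1 → Cor22.dmod P = 1 → Cor22.ThetaDataExistsAt P l₀ →
    Cor22.logQAvoid P {2, l₀} ≤ c * (P.logDiff + Cor22.logCondAvoid P {2, l₀}) + A

theorem W5_of_W4 {l₀ : ℕ} (h5 : 5 ≤ l₀) (h : W4 l₀) : W5 l₀ := by
  obtain ⟨A, hA⟩ := h
  have hl : (5 : ℝ) ≤ l₀ := by exact_mod_cast h5
  set κ : ℝ := 1 / 6 - 2 / ((l₀ : ℝ) * ((l₀ : ℝ) + 1)) with hκ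
  have hκ0 : 0 < κ := by
    rw [hκ]
    have h30 : (30 : ℝ) ≤ (l₀ : ℝ) * ((l₀ : ℝ) + 1) := by nlinarith
    have : 2 / ((l₀ : ℝ) * ((l₀ : ℝ) + 1)) ≤ 2 / 30 := by
      apply div_le_div_of_nonneg_left (by norm_num) (by norm_num) h30
    linarith
  refine ⟨(1 + 12 / (l₀ : ℝ)) / κ, A / κ, fun P hAd hdeg hd hT => ?_⟩
  have h4 := hA P hAd hdeg hd hT
  have hL0 : 0 ≤ P.logDiff + Cor22.logCondAvoid P {2, l₀} :=
    add_nonneg P.logDiff_nonneg (Cor22.logCondAvoid_nonneg P _)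
  rw [div_mul_eq_mul_div, ← add_div, le_div_iff₀ hκ0]
  linarith

/-! ## W6, W7 — weaken the GROWTH (below Szpiro shape) -/

/-- **W7 l₀** — STEWART–YU SHAPE `(θ, m) = (1/3, 3)` on the sub-family: `log q^{∤2l₀} ≤ C·exp(L/3)·(1 + L)^3`, `L = log-diff + log-cond`.
THEOREM IN PRINT for the rational Legendre family via the Frey/Legendre dictionary (`λ = a/b ↦` the triple `(a, b − a, b)`;
[StewartYu2001, Thm 1] = the tree's FACT `Literature.NumberTheory.DiophantineGeometry.stewart_yu`, by name
`Literature.Barriers.ABC.BakerMethodBounds`); NOT in the kernel (fact undischarged, dictionary not typed). -/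
def W7 (l₀ : ℕ) : Prop :=
  ∃ C : ℝ, ∀ P : NFPoint, Admissible P l₀ → P.degree = 1 → Cor22.dmod P = 1 → Cor22.ThetaDataExistsAt P l₀ →
    Cor22.logQAvoid P {2, l₀} ≤
      C * Real.exp ((P.logDiff + Cor22.logCondAvoid P {2, l₀}) / 3) * (1 + (P.logDiff + Cor22.logCondAvoid P {2, l₀})) ^ 3

/-- **W6 l₀** — SUB-STEWART–YU: some exponent `θ < 1/3` (any log-power `m`). OPEN in print (would beat the Baker-method record
`Literature.Barriers.ABC.BakerMethodBounds`, scope caveat (a): no impossibility theorem, «new ideas needed»). -/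
def W6 (l₀ : ℕ) : Prop :=
  ∃ θ : ℝ, θ < 1 / 3 ∧ ∃ C : ℝ, ∃ m : ℕ, ∀ P : NFPoint, Admissible P l₀ → P.degree = 1 → Cor22.dmod P = 1 →
    Cor22.ThetaDataExistsAt P l₀ →
    Cor22.logQAvoid P {2, l₀} ≤
      C * Real.exp (θ * (P.logDiff + Cor22.logCondAvoid P {2, l₀})) * (1 + (P.logDiff + Cor22.logCondAvoid P {2, l₀})) ^ m

/-- Szpiro shape ⟹ sub-Stewart–Yu shape (`θ = 0`, `m = 1`): three lines of real arithmetic. -/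
theorem W6_of_W5 {l₀ : ℕ} (h : W5 l₀) : W6 l₀ := by
  obtain ⟨c, A, hcA⟩ := h
  refine ⟨0, by norm_num, |c| + |A|, 1, fun P hAd hdeg hd hT => ?_⟩
  have h5 := hcA P hAd hdeg hd hT
  set L : ℝ := P.logDiff + Cor22.logCondAvoid P {2, l₀} with hL
  have hL0 : 0 ≤ L := add_nonneg P.logDiff_nonneg (Cor22.logCondAvoid_nonneg P _)
  rw [zero_mul, Real.exp_zero, mul_one, pow_one]
  have hc : c * L ≤ |c| * L := mul_le_mul_of_nonneg_right (le_abs_self c) hL0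
  have hA' : A ≤ |A| := le_abs_self A
  have hc' : |c| * L ≤ |c| * (1 + L) := by nlinarith [abs_nonneg c]
  have hA'' : |A| ≤ |A| * (1 + L) := by nlinarith [abs_nonneg A]
  nlinarith [abs_nonneg c, abs_nonneg A]

/-! ## The chain, assembled: `W0 ⟹ W1 ⟹ W2`, `W1 ⟹ W3 ⟹ W4 ⟹ W5 ⟹ W6 (⟹ W7)`; `W1T`, `W8` are theorems -/

theorem W3_isConsequence {l₀ : ℕ} (h7 : 7 ≤ l₀) : IsConsequence (W3 l₀) :=
  fun h => W3_of_W1 h7 (W1_isConsequence l₀ h)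

theorem W5_isConsequence {l₀ : ℕ} (h7 : 7 ≤ l₀) : IsConsequence (W5 l₀) :=
  fun h => W5_of_W4 (le_trans (by norm_num) h7) (W4_of_W3 (W3_of_W1 h7 (W1_isConsequence l₀ h)))

theorem W6_isConsequence {l₀ : ℕ} (h7 : 7 ≤ l₀) : IsConsequence (W6 l₀) :=
  fun h => W6_of_W5 (W5_isConsequence h7 h)

/-! ## In-Lean falsifier arithmetic (numbers quoted in the memo) -/

/-- Slope of `W4` at `l₀ = 7`: `(1 + 12/7)/(1/6 − 2/56) = 19/7 · 168/22 = 228/11 ≈ 20.73`. -/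
example : (1 + 12 / (7 : ℝ)) / (1 / 6 - 2 / ((7 : ℝ) * (7 + 1))) = 228 / 11 := by norm_num

/-- Slope at `l₀ = 47`: `(1 + 12/47)·(1/6 − 2/2256)⁻¹ = (59/47)·(1128/187) = 1416/187 ≈ 7.57` — below the largest known Szpiro
ratios (`< 9`), but the slack threshold `5529600·47⁴ ≈ 2.7·10¹³` nats is beyond every tabulated curve. -/
example : (1 + 12 / (47 : ℝ)) / (1 / 6 - 2 / ((47 : ℝ) * (47 + 1))) = 1416 / 187 := by norm_num

/-- The slack threshold at `l₀ = 7`: `5529600 · 7⁴ = 13 276 569 600` nats. -/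
example : (5529600 : ℕ) * 7 ^ 4 = 13276569600 := by norm_num

end Summit.ABC.ABC.Cruxes.ThetaPartII.WUC3

end
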